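/-
Copyright (c) 2026. Released under the Apache 2.0 license.
-/
import Summits.BirchSwinnertonDyer.BirchSwinnertonDyer.Theses.ManinLocalTwoThree
import Literature.NumberTheory.EllipticCurves.NewformCuspFourierValuation
import Literature.NumberTheory.EllipticCurves.CuspFormLFunction
import Literature.NumberTheory.EllipticCurves.ManinConstantModularDegree
import Literature.NumberTheory.EllipticCurves.CongruenceNumber
import HarnessLib

/-!
# Line `neron_partner` for crux C5 = `ManinLocalTwoThree.ManinPrimeToAdditiveFiveLe`
# (ideator bsd-idea-19 g3, lens DUAL; crux item stmt-BirchSwinnertonDyer-22969)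

**Published line, NOT the skeleton of record** (W-79; record = `Lines/upper_anchor.lean`).
Card: `Lines/neron-partner.md`; idea: `Ideas/manin-partner-form.md`.

## The dual object

Fix `p ≥ 5` with `p² ∣ N` (so `v_p(N) = 2`, `N = p² M`), `f` the newform, `φ : X₀(N) → E` the
OPTIMAL parametrisation (the crux's lattice clause), `m_E = deg φ`, `c = c_E` the Manin constant.
Inside `S₂(Γ₀(N); ℚ)` sit two `ℤ_(p)`-lattices: `S` = forms with `p`-integral `q`-expansion at `∞`
(the tree's `integralCuspForms0`, ⊗ `ℤ_(p)`) and the **Néron–de Rham lattice**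
`L := H⁰(X₀(N)_{ℤ_(p)}, ω) = Cot(𝒥₀(N))` (ČNS: `X₀(N)_{ℤ_(p)}` has rational singularities, so
`Pic⁰ = 𝒥⁰` and Grothendieck duality identifies global sections of the dualising sheaf with the
cotangent space of the Néron model). For a lattice `Λ ∋ f` put
`b_p(Λ) := max {k : ∃ η ∈ Λ, λ_f(η) = p^{-k}}`, `λ_f(η) = ⟨f, η⟩/⟨f, f⟩` the `f`-coordinate.
Then `b_p(S) = v_p(r_E)` (congruence number, ARS (i)⇔(ii)) and — THE IDENTITY of this line —

  `v_p(c_E) = v_p(m_E) − b_p(L)`      (`≥`: stub `stub_neronIntegrality`, the ONLY direction C5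
                                        uses — the ČNS mechanism run on an arbitrary `η ∈ L`, no BLR;
                                        `≤`: `NeronPartnerConverse`, BLR 7.5/4, not load-bearing),

proved in print-sized steps: ČNS Thm. 5.15 (`ω_f ∈ L`), BLR 7.5/4 (the closed immersion
`E' = φ^∨(E) ↪ J₀(N)` extends to a closed immersion of Néron models because `e(ℚ_p/ℚ_p) = 1 < p−1`,
hence `Cot 𝒥 ↠ Cot ℰ'`), `φ ∘ φ^∨ = [m_E]`, `φ^* ω_E = c ω_f`. So ČNS's `c ∣ deg φ` is `b_p(L) ≥ 0`,
and C5 ⟺ `b_p(L) = v_p(m_E)` ⟺ the Hecke idempotent `e_f = (φ^∨φ)/m_E` has the SAME denominator on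
the Néron Lie algebra `Lie 𝒥₀(N) ⊗ ℤ_p` as on `H₁(X₀(N), ℤ_p)`. SANDWICH:
`b_p(L) ≤ v_p(m_E) ≤ v_p(r_E) = b_p(S)`; the total defect `length S/(L + S ∩ f^⊥)` splits as
`v_p(r_E/m_E)` (Agashe–Ribet–Stein) `+ v_p(c_E)` (Manin). In particular `v_p(c_E)` becomes
COMPUTABLE from `q`-expansions and modular symbols alone — an answer, for elliptic optimal quotients
at `p ≥ 5`, to ARS06 Remark 3.6 ("find an algorithm to compute `c_A` exactly").

## The lattice `L` by cusp contents (the certificate)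

`X₀(N)_{𝔽_p} = C_∞ ∪ C_0 ∪ Ξ` (Edixhoven 1990 §1.1.3: three copies of `X₀(M)_{𝔽_p}`,
multiplicities `1, 1, p − 1`; `Ξ` carries the cusps of denominator `L` with `v_p(L) = 1`, e.g.
`1/(pM) = (1 0; pM 1)∞`, width `N/gcd(L², N) = 1`). The local ring of `X₀(N)_{ℤ_p}` at the generic
point of `Ξ` is tamely ramified of index `p − 1` over `ℤ_p`, with different exponent `p − 2`, so
`ord_Ξ(η) = (p−1)·val_p(η|_{1/(pM)}) + (p−2)`, while `ord_{C_∞}(η) = val_p(η|_∞)`,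
`ord_{C_0}(η) = val_p(η|_0) + v_p(N)` (ČNS §4.2 valuations `val_p(f|𝔠) = inf_n val_p a_f(n;γ)`,
tree `fourierCoeffAtCusp`). Hence, for `η ∈ S₂(Γ₀(N); ℚ)`:

  `η ∈ L ⟺ val_p(η|_∞) ≥ 0 ∧ val_p(η|_0) ≥ −2 ∧ val_p(η|_{1/(pM)}) ≥ −(p−2)/(p−1) = −1 + 1/(p−1)`

— which is ČNS Prop. 5.14 (p. 39) VERBATIM (one cusp per `ℓ = val_p(L)`; transcribed in the tree's
`NewformCuspFourierValuation.lean`, whose three rows are proved there from the named fact Cor. 4.7).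

Checks: `ω_f`: ČNS Cor. 4.7 gives `val_p(f|_{1/(pM)}) ≥ −1/2` (sharp for elliptic `f`, Ex. 4.8), and
`−1/2 ≥ −(p−2)/(p−1)` iff `p ≥ 3` — so `ord_Ξ(ω_f) = (p−3)/2 ≥ 0`, borderline at `3`, failing at
`2`: exactly ČNS's exceptional primes. `h(pz)` for `h` `p`-new of level `pM` has middle content `−1`
(`∉ L`, `p·h(pz) ∈ L`); `h₀(p²z)` for `h₀` of level `M` has contents `−2` at `0` and at `1/(pM)`.
Symmetrising under the Fricke involution `w_N` (an automorphism of `X₀(N)_{ℤ_p}` fixing `Ξ`,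
swapping `C_∞, C_0`, with `w_N f = ε f`) one may take `η` `ε`-pure, and then the condition at `0`
follows from the one at `∞`. This gives `NeronPartnerDepth` below and the MANIN PARTNER FORM:
C5(E, p) ⟺ ∃ `g = f − p^m η ∈ S ∩ f^⊥`, `w_N g = ε g`, `f ≡ g (mod p^m)` at `∞`, and
`val_p((f − g)|_{1/(pM)}) > m − 1`, `m = v_p(m_E)` (a finite exact linear-algebra certificate over
`ℤ[ζ_p]/p^{m+1}`: kit test F3 of the card runs it on Cremona's range, where `c = 1` predicts success).
The middle-cusp condition is an `ε`-factor compatibility: `f|(1 0; pM 1) = ε (f|τ_{−1/p})|w_N`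
expands in Gauss-sum-weighted twists `f ⊗ χ` (`χ mod p`) carrying the local root numbers
`ε_p(f ⊗ χ)` — the de Rham shadow of the type-gluing of `Ideas/cross-type-gluing.md`.

## Shape
Two registered-style stubs (NOT registered: W-79) and the sorry-free composition
`ManinPrimeToAdditiveFiveLe_of : stub₁ → stub₂ → C5` concluding the crux BY NAME. `stub_partnerExists`
is C5 in the certificate currency (the Transfer); `stub_neronIntegrality` is the port of the ČNS
mechanism to an arbitrary `η` (Prop. 5.14 ⇒ `η ∈ H⁰(X₀(N)_{ℤ_(p)}, ω) ⊆ Cot 𝒥` by rational singularities ⇒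
Néron functoriality of `φ^∨` ⇒ `(m/c) λ_f(η) ∈ ℤ_(p)`), size L; the converse (BLR 7.5/4, `e = 1 < p − 1`)
is stated as `NeronPartnerConverse` and is what makes `b_p(L)` an EXACT invariant (kit test F3 decisive),
but C5 does not need it (rev 3).

## Where the certificate is new (rev 4, answering the critic's P4)
For optimal ELLIPTIC curves the identity only re-derives what Cremona's `c = 1` tables already say; the
lattice `L` earns its keep for NEWFORM QUOTIENTS `A_f` of dimension `d ≥ 2`, where Agashe–Ribet–Stein
(Def. 3.3, Conj. 3.12, Rem. 3.6) define `c_A = [S₂(ℤ)[I] : ψ(H⁰(𝒜, Ω¹))]`, conjecture `c_{A_f} = 1`, and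
have no algorithm and 28 data points at non-squarefree level. The same chain (Néron mapping property for
`π : J → A`; `Cot 𝒥 = H⁰(X^{reg}, ω) ⊆ H⁰(X₀(N), Ω)`; Prop. 5.14) gives the COMPUTABLE LOWER BOUND
`v_ℓ(c_A) ≥ a_ℓ(A) := length(S₂(ℤ_(ℓ))[I] / (S₂(ℤ_(ℓ))[I] ∩ L_ℓ))`, so Conj. 3.12 predicts that every
`ℤ_(ℓ)`-integral form of an isotypic component — every divided inner congruence — keeps the middle-cusp
contents: kit test F4 of `Lines/neron-partner-F3.md` §6 measures it (any `a_ℓ > 0` is a candidate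
counterexample to the generalized Manin conjecture; `a_ℓ = 0` throughout is evidence for the alignment
mechanism behind `stub_partnerExists`). Not typed here: the tree has no Néron models. BSD is not proved
by any of this.
-/

noncomputable section

open scoped MatrixGroups ModularForm

open CongruenceSubgroup UpperHalfPlane
open Literature.NumberTheory.EllipticCurves.ModularForms

set_option linter.dupNamespace false

namespace Summit.BirchSwinnertonDyer.BirchSwinnertonDyer.Cruxes.ManinPrimeToAdditiveFiveLe.NeronPartner

/-- The representative `γ_mid = (1 0; N/p 1) ∈ SL₂(ℤ)` of the "middle" cusp `1/(N/p)` of `Γ₀(N)`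
(for `N = p²M`: the cusp `1/(pM)`, denominator `pM`, width `1`, lying on the multiplicity-`(p−1)`
component `Ξ` of `X₀(N)_{𝔽_p}`). -/
def midCusp (N p : ℕ) : SL(2, ℤ) :=
  ⟨!![1, 0; ((N / p : ℕ) : ℤ), 1], by simp [Matrix.det_fin_two]⟩

/-- **Néron partner of depth `k`.** `NeronPartnerDepth p N f k`: there is a cusp form `η` on
`Γ₀(N)` of weight `2` with RATIONAL `q`-expansion at `∞`, `w_N`-pure with the sign of `f`
(`frickeInvolution N 2 η = ε(f) • η`), lying in the Néron–de Rham lattice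
`L = H⁰(X₀(N)_{ℤ_(p)}, ω)` as read off its cusp contents — `p`-integral at `∞` (a prime-to-`p`
multiple lies in the tree's `integralCuspForms0 N 2 = S₂(Γ₀(N); ℤ)`; hence integral at `0` too, by the
sign) and `val_p(η|_{1/(N/p)}) ≥ −1 + 1/(p−1) = −(p−2)/(p−1)` at the middle cusp (LITERALLY the middle
row of ČNS Prop. 5.14 with `val_p(N/L) = 1`, tree `norm_fourierCoeffAtCusp_le_rpow_of_pos_of_lt`),
valuations taken through every
`ι : ℚ̄_p^alg ≃ ℂ` as in the tree's rendering of ČNS Cor. 4.7 — and with `f`-coordinate exactly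
`p^{-k}`: `⟨f, f − p^k η⟩ = 0`. Informally: `k ≤ b_p(L)`. For the newform of an optimal curve the
identity stub says this holds iff `k + v_p(c_E) ≤ v_p(deg φ)`. -/
def NeronPartnerDepth (p N : ℕ) [Fact p.Prime] [NeZero N] (f : CuspForm (Gamma0 N) 2) (k : ℕ) :
    Prop :=
  ∃ g : CuspForm (Gamma0 N) 2,
    (∃ s : ℕ, ¬ p ∣ s ∧ (s : ℤ) • g ∈ integralCuspForms0 N 2) ∧
    frickeInvolution N 2 g = frickeEigenvalue f • g ∧
    (∀ (ι : PadicAlgCl p ≃+* ℂ) (n : ℕ),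
      ‖ι.symm (fourierCoeffAtCusp N 2 ⇑g (midCusp N p) n)‖ ≤
        (p : ℝ) ^ ((1 : ℝ) - 1 / ((p : ℝ) - 1))) ∧
    peterssonProduct (Gamma0 N) 2 f (f - ((p : ℂ) ^ k) • g) = 0

/-- `γ_mid` has denominator `N/p` (`gcd(N/p, N) = N/p` as `p ∣ N`). -/
theorem cuspDenominator_midCusp {N p : ℕ} (hpN : p ∣ N) :
    cuspDenominator N (midCusp N p) = N / p := by
  have h : ((midCusp N p : Matrix (Fin 2) (Fin 2) ℤ) 1 0) = ((N / p : ℕ) : ℤ) := rfl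
  rw [cuspDenominator, h, Int.natAbs_natCast, Nat.gcd_eq_left (Nat.div_dvd_of_dvd hpN)]

/-- **Depth `0` is ČNS (sanity rung, sorry-free from the tree's named fact Cor. 4.7).** For the newform
`f` of `W` at a level with `v_p(N) = 2`, `NeronPartnerDepth p N f 0` holds with `η = f`: rational
`q`-expansion (`a_n(f) = a_n(W) ∈ ℤ`), `w_N f = ε(f) f` (Atkin–Lehner, tree `_holds`), integrality at
`∞` and the middle-cusp bound `val_p(f|_{1/(N/p)}) ≥ −1 + 1/(p−1)` are the rows of ČNS Prop. 5.14
proved in the tree from Cor. 4.7, and `⟨f, f − f⟩ = 0`. By the identity stub this is `v_p(c) ≤ v_p(deg)`,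
i.e. exactly ČNS Thm. 1.2 at `p` — the dictionary of this line agrees with print at depth `0`. -/
theorem neronPartnerDepth_zero (h47 : cesnaviciusNeururerSaha_cor_4_7)
    {W : WeierstrassCurve ℚ} {N : ℕ} [NeZero N] {f : CuspForm (Gamma0 N) 2} (hf : IsNewformOf W f)
    {p : ℕ} [Fact p.Prime] (hN : padicValNat p N = 2) : NeronPartnerDepth p N f 0 := by
  have hp : p.Prime := Fact.out
  have hpN : p ∣ N := dvd_of_one_le_padicValNat (by omega)
  have hspan : f ∈ Submodule.span ℤ (newforms0 N 2) := Submodule.subset_span hf.1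
  have hL : padicValNat p (cuspDenominator N (midCusp N p)) = 1 := by
    rw [cuspDenominator_midCusp hpN, padicValNat.div hpN, hN]
  refine ⟨f, ⟨1, hp.not_dvd_one, ?_⟩, ?_, ?_, ?_⟩
  · rw [Nat.cast_one, one_zsmul, mem_integralCuspForms0]
    exact fun n ↦ ⟨W.LFunction n, (hf.2 n).symm⟩
  · exact IsNewform0.frickeInvolution_eq_smul_holds hf.1
  · intro ι n
    have h := norm_fourierCoeffAtCusp_le_rpow_of_pos_of_lt h47 f hspan (midCusp N p) ι n
      (by omega) (by omega)
    rwa [hL, hN, show ((2 - 1 : ℕ) : ℝ) = 1 by norm_num] at h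
  · rw [pow_zero, one_smul, sub_self, ← peterssonProductₗ_apply, map_zero]

/-- **Sandwich, lower half (sorry-free): a Manin partner at depth `k` forces `p ^ k ∣ r_f`.**
If `f ≠ 0` has integral coefficients and `NeronPartnerDepth p N f k` holds with partner `g`
(`s • g` integral with `p ∤ s`, `⟨f, f − p^k g⟩ = 0`), then `z = s f − p^k (s g)` lies in `(ℤf)^⊥`, the
class of `s g` in `S₂(Γ₀(N); ℤ)/(ℤf + (ℤf)^⊥)` has additive order EXACTLY `p ^ k` (pairing with `f`:
`m s ⟨f, g⟩ = a ⟨f, f⟩ = a p^k ⟨f, g⟩`, `⟨f, g⟩ ≠ 0`, `gcd(p, s) = 1 ⇒ p^k ∣ m`), and the order divides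
`Nat.card` = `congruenceNumber f` (ARS 2012 §2.1, definition (ii)). With `k = b_p(L)` this is the half
`b_p(L) ≤ v_p(r_E)` of the sandwich `b_p(L) ≤ v_p(m_E) ≤ v_p(r_E) = b_p(S)`; the cusp / Atkin–Lehner clauses
of the partner are NOT used here — they are what bounds `k` by `v_p(m_E)` (stub 1). [folklore; adapts the
tree's `dvd_congruenceNumber_of_sub_eq_smul` to a `p`-unit denominator `s`] -/
theorem pow_dvd_congruenceNumber_of_neronPartnerDepth {N : ℕ} [NeZero N] {p : ℕ} [Fact p.Prime]
    {f : CuspForm (Gamma0 N) 2} (hf0 : f ≠ 0) (hfint : f ∈ integralCuspForms0 N 2) {k : ℕ}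
    (h : NeronPartnerDepth p N f k) : p ^ k ∣ congruenceNumber f := by
  obtain ⟨g, ⟨s, hps, hsg⟩, -, -, hpet⟩ := h
  have hp : p.Prime := Fact.out
  set L := integralCuspForms0 N 2
  set H : Submodule ℤ L := ((ℤ ∙ f) ⊔ integralOrthogonal0 f).comap L.subtype
  -- the pairing with `f`, as a `ℤ`-linear map
  set P : CuspForm (Gamma0 N) 2 →ₗ[ℤ] ℂ := (peterssonProductₗ (Gamma0 N) 2 f).restrictScalars ℤ
  have hPf : P f ≠ 0 := by
    intro h0
    have hpos := peterssonProduct_self_pos_holds (Gamma0 N : Subgroup (GL (Fin 2) ℝ)) 2 hf0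
    have h0' : peterssonProduct (Gamma0 N) 2 f f = 0 := h0
    rw [h0', Complex.zero_re] at hpos
    exact lt_irrefl _ hpos
  -- `⟨f, f⟩ = p^k ⟨f, g⟩`
  have hfg : P f = (p : ℂ) ^ k * P g := by
    have e : peterssonProductₗ (Gamma0 N) 2 f (f - ((p : ℂ) ^ k) • g) = 0 := by
      rw [peterssonProductₗ_apply]
      exact hpet
    rw [map_sub, map_smul, smul_eq_mul, sub_eq_zero] at e
    exact e
  have hPg : P g ≠ 0 := by
    intro h0
    rw [h0, mul_zero] at hfg
    exact hPf hfg
  -- elements of `(ℤf + (ℤf)^⊥) ∩ S₂(Γ₀(N); ℤ)` pair with `f` to integer multiples of `⟨f, f⟩`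
  have hHP : ∀ x : L, x ∈ H → ∃ a : ℤ, P x = a * P f := by
    intro x hx
    rw [Submodule.mem_comap, Submodule.subtype_apply, Submodule.mem_sup] at hx
    obtain ⟨y, hy, z, hz, hyz⟩ := hx
    obtain ⟨a, rfl⟩ := Submodule.mem_span_singleton.mp hy
    refine ⟨a, ?_⟩
    have hPz : P z = 0 := (mem_integralOrthogonal0.mp hz).2
    rw [← hyz, map_add, hPz, add_zero, map_zsmul, zsmul_eq_mul]
  -- the integral orthogonal form `z = s f − p^k (s g)`
  have hz : (s : ℤ) • f - (p ^ k : ℕ) • ((s : ℤ) • g) ∈ integralOrthogonal0 f := by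
    rw [mem_integralOrthogonal0]
    refine ⟨sub_mem (L.smul_mem (s : ℤ) hfint) (nsmul_mem hsg (p ^ k)), ?_⟩
    change P ((s : ℤ) • f - (p ^ k : ℕ) • ((s : ℤ) • g)) = 0
    rw [map_sub, map_nsmul, map_zsmul, map_zsmul, hfg, nsmul_eq_mul, zsmul_eq_mul, zsmul_eq_mul]
    push_cast
    ring
  -- the class of `s g` has order exactly `p ^ k` in the quotient
  set x : L := ⟨(s : ℤ) • g, hsg⟩
  set q : L ⧸ H.toAddSubgroup := (x : L ⧸ H.toAddSubgroup)
  have hq : addOrderOf q = p ^ k := by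
    rw [addOrderOf_eq_iff (pow_pos hp.pos k)]
    refine ⟨?_, fun m hm hm0 habs ↦ ?_⟩
    · rw [← QuotientAddGroup.mk_nsmul, QuotientAddGroup.eq_zero_iff, Submodule.mem_toAddSubgroup,
        Submodule.mem_comap, Submodule.subtype_apply]
      have hcoe : ((p ^ k • x : L) : CuspForm (Gamma0 N) 2) =
          (s : ℤ) • f - ((s : ℤ) • f - (p ^ k : ℕ) • ((s : ℤ) • g)) := by
        rw [sub_sub_cancel]
        rfl
      rw [hcoe]
      exact Submodule.sub_mem_sup (Submodule.mem_span_singleton.mpr ⟨s, rfl⟩) hz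
    · rw [← QuotientAddGroup.mk_nsmul, QuotientAddGroup.eq_zero_iff,
        Submodule.mem_toAddSubgroup] at habs
      obtain ⟨a, ha⟩ := hHP _ habs
      have hm' : (m : ℂ) * P ((s : ℤ) • g) = a * P f := by
        rw [← ha, ← nsmul_eq_mul, ← map_nsmul]
        rfl
      rw [map_zsmul, zsmul_eq_mul, hfg, ← mul_assoc, ← mul_assoc] at hm'
      have hms : (m : ℂ) * (s : ℤ) = a * (p : ℂ) ^ k := mul_right_cancel₀ hPg hm'
      have hms' : ((m * s : ℕ) : ℤ) = a * (p ^ k : ℕ) := by exact_mod_cast hms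
      have hdvd : p ^ k ∣ m * s := Int.natCast_dvd_natCast.mp ⟨a, by rw [hms', mul_comm]⟩
      have hdvd' : p ^ k ∣ m :=
        (Nat.Coprime.pow_left k ((Nat.Prime.coprime_iff_not_dvd hp).mpr hps)).dvd_of_dvd_mul_right hdvd
      exact absurd (Nat.le_of_dvd hm0 hdvd') (not_le.mpr hm)
  calc p ^ k = addOrderOf q := hq.symm
    _ ∣ Nat.card (L ⧸ H.toAddSubgroup) := addOrderOf_dvd_natCard q

/-- **Corollary (sorry-free): depth `≤ v_p(r_E)` for a modular parametrisation datum.** For a datum `D`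
of `W` at level `N` and any `k` with `NeronPartnerDepth p N D.f k`: if `congruenceNumber D.f ≠ 0` (the
ARS quotient is finite — in nature `r_E` is a positive integer) then `k ≤ v_p(congruenceNumber D.f)`.
So the depth `b_p(L)` is a bounded invariant, `b_p(L) ≤ v_p(r_E) = b_p(S)`; stub 1 sharpens the bound
to `v_p(m_E)` and identifies the slack as `v_p(c_E)`. -/
theorem neronPartnerDepth_le_padicValNat_congruenceNumber {W : WeierstrassCurve ℚ} {N : ℕ}
    [NeZero N] (D : ModularParametrizationData W N) {p : ℕ} [Fact p.Prime] {k : ℕ}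
    (h : NeronPartnerDepth p N D.f k) (hr : congruenceNumber D.f ≠ 0) :
    k ≤ padicValNat p (congruenceNumber D.f) := by
  have hf0 : D.f ≠ 0 := fun h0 ↦ D.isNewformOf.1.coe_ne_zero (by rw [h0]; rfl)
  exact (padicValNat_dvd_iff_le hr).mp
    (pow_dvd_congruenceNumber_of_neronPartnerDepth hf0 D.f_mem_integralCuspForms0 h)

/-- **Stub 1 (integrality of the Néron pull-back; port of the ČNS mechanism; L).** For the datum `D`
of a globally minimal `W` with the OPTIMALITY clause `Λ_W = c · Λ_f`, at a prime `p ≥ 5` with `p² ∣ N`,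
and ANY depth-`k` lattice element `η` (`NeronPartnerDepth p N D.f k`): `k + v_p(c) ≤ v_p(deg)` — i.e.
`b_p(L) ≤ v_p(m_E) − v_p(c_E)`. This is the ONLY direction the composition uses, and it is ČNS's proof
of `c ∣ deg φ` run with `ω_f` replaced by `η`: (i) the three cusp contents ⇒ `η ∈ H⁰(X₀(N)_{ℤ̄_p}, Ω)`
(ČNS Prop. 5.14, print; tree transcription); (ii) rational singularities of `X₀(N)` at `p ≥ 5` ⇒
`H⁰(X₀(N)_{ℤ_(p)}, Ω) ⊆ H⁰(𝒥_{ℤ_(p)}, Ω¹) = Cot 𝒥` (ČNS, the step behind their Thm. 1.2); (iii) Néron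
functoriality of `φ^∨ : E → J₀(N)` ⇒ `(φ^∨)^* Cot 𝒥 ⊆ Cot ℰ = ℤ_(p) ω_E` (NO closed-immersion / BLR input);
(iv) `φ ∘ φ^∨ = [deg]`, `φ^* ω_W = c ω_f`, and `(φ^∨)^*` kills `f^⊥ = (1 − e_f) S₂` (Hecke-equivariance,
multiplicity one, `E = A_f` by the optimality clause) ⇒ `(φ^∨)^* η = λ_f(η) (deg/c) ω_E`, so
`p^{-k} deg / c ∈ ℤ_(p)`. Uniform in `ρ̄_{E,p}` (reducible or not) and in `p ≥ 5`. -/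
theorem stub_neronIntegrality :
    exists_isNewformOf →
    ∀ (W : WeierstrassCurve ℚ) [W.IsElliptic] [W.IsGloballyMinimal] {N : ℕ} [NeZero N]
      (D : ModularParametrizationData W N),
      (∀ z ∈ D.L.lattice, ∃ w ∈ periodLattice D.f, z = D.c * w) →
      ∀ (p : ℕ) [Fact p.Prime], 5 ≤ p → p ^ 2 ∣ N → ∀ k : ℕ,
        NeronPartnerDepth p N D.f k →
          (k : ℤ) + padicValInt p D.maninConstant ≤ (padicValNat p D.modularDegree : ℤ) := by
  sorry

/-- **The converse inequality (NOT load-bearing for C5; stated, not stubbed).** `k + v_p(c) ≤ v_p(deg) ⇒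
NeronPartnerDepth p N D.f k`, i.e. `b_p(L) ≥ v_p(m_E) − v_p(c_E)`, hence with stub 1 the IDENTITY
`v_p(c_E) = v_p(m_E) − b_p(L)`. Proof route: BLR 7.5/4 — the closed immersion `E = A_f ↪ J₀(N)` extends
to a closed immersion of Néron models over `ℤ_(p)` because `e(ℚ_p) = 1 < p − 1` — so `Cot 𝒥 ↠ Cot ℰ` is
SURJECTIVE and some `η ∈ L = Cot 𝒥` (ε-pure after averaging with `w_N`, which preserves `L` and `λ_f`)
has `λ_f(η) (deg/c) ∈ ℤ_(p)^×`; plus the `⇒` direction of Prop. 5.14 and `Cot 𝒥 ⊆ H⁰(X₀(N)_{ℤ_(p)}, Ω)`.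
It is what makes `b_p(L)` an exact, computable invariant — the decisiveness of kit test F3 — and is
recorded here as a `Prop` so that a disprover/kit seat can cite it; no `sorry` is spent on it. -/
def NeronPartnerConverse : Prop :=
    exists_isNewformOf →
    ∀ (W : WeierstrassCurve ℚ) [W.IsElliptic] [W.IsGloballyMinimal] {N : ℕ} [NeZero N]
      (D : ModularParametrizationData W N),
      (∀ z ∈ D.L.lattice, ∃ w ∈ periodLattice D.f, z = D.c * w) →
      ∀ (p : ℕ) [Fact p.Prime], 5 ≤ p → p ^ 2 ∣ N → ∀ k : ℕ,
        (k : ℤ) + padicValInt p D.maninConstant ≤ (padicValNat p D.modularDegree : ℤ) →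
          NeronPartnerDepth p N D.f k

/-- **Stub 2 (the crux in certificate currency = the Transfer; open).** The newform of an optimal
curve with additive reduction at `p ≥ 5` has a Néron partner of full Betti depth `v_p(deg φ)`:
equivalently `b_p(L) = v_p(m_E)`, equivalently the MANIN PARTNER FORM `g` of the module docstring
exists. Why easier than C5 as typed: it is a statement about ONE explicit lattice of cusp forms,
decidable per level by finite linear algebra (kit F3), and its failure mode is named (a congruence
`f ≡ g (p^m)` realised only through `p`-old or flipped-type constituents at the Kummer corner
`e = p − 1`). -/
theorem stub_partnerExists :
    exists_isNewformOf →
    ∀ (W : WeierstrassCurve ℚ) [W.IsElliptic] [W.IsGloballyMinimal] {N : ℕ} [NeZero N]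
      (D : ModularParametrizationData W N),
      (∀ z ∈ D.L.lattice, ∃ w ∈ periodLattice D.f, z = D.c * w) →
      ∀ (p : ℕ) [Fact p.Prime], 5 ≤ p → p ^ 2 ∣ N →
        NeronPartnerDepth p N D.f (padicValNat p D.modularDegree) := by
  sorry

/-- **Composition (sorry-free): the two stubs give the crux BY NAME.** With `k₀ = v_p(deg)`, the
partner of depth `k₀` and the identity give `k₀ + v_p(c) ≤ k₀`, so `v_p(c) ≤ 0`, and `c ≠ 0`
(`maninConstant_ne_zero_holds`) turns this into `p ∤ c`. The three semistable Manin facts bound by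
the crux are not used (they serve the route's other conjuncts). -/
theorem ManinPrimeToAdditiveFiveLe_of
    (h₁ : exists_isNewformOf →
      ∀ (W : WeierstrassCurve ℚ) [W.IsElliptic] [W.IsGloballyMinimal] {N : ℕ} [NeZero N]
        (D : ModularParametrizationData W N),
        (∀ z ∈ D.L.lattice, ∃ w ∈ periodLattice D.f, z = D.c * w) →
        ∀ (p : ℕ) [Fact p.Prime], 5 ≤ p → p ^ 2 ∣ N → ∀ k : ℕ,
          NeronPartnerDepth p N D.f k →
            (k : ℤ) + padicValInt p D.maninConstant ≤ (padicValNat p D.modularDegree : ℤ))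
    (h₂ : exists_isNewformOf →
      ∀ (W : WeierstrassCurve ℚ) [W.IsElliptic] [W.IsGloballyMinimal] {N : ℕ} [NeZero N]
        (D : ModularParametrizationData W N),
        (∀ z ∈ D.L.lattice, ∃ w ∈ periodLattice D.f, z = D.c * w) →
        ∀ (p : ℕ) [Fact p.Prime], 5 ≤ p → p ^ 2 ∣ N →
          NeronPartnerDepth p N D.f (padicValNat p D.modularDegree)) :
    Summit.BirchSwinnertonDyer.BirchSwinnertonDyer.Theses.ManinLocalTwoThree.ManinPrimeToAdditiveFiveLe := by
  intro _hMazur _hAU _hCes hnf W _ _ N _ D hopt p hp hp5 hpN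
  haveI : Fact p.Prime := ⟨hp⟩
  have hdepth := h₂ hnf W D hopt p hp5 hpN
  have hle : (padicValNat p D.modularDegree : ℤ) + padicValInt p D.maninConstant ≤
      (padicValNat p D.modularDegree : ℤ) := h₁ hnf W D hopt p hp5 hpN _ hdepth
  have hval : padicValInt p D.maninConstant ≤ 0 := by linarith
  intro hdvd
  have hc0 : D.c ≠ 0 := D.maninConstant_ne_zero_holds
  rcases (padicValInt_dvd_iff (p := p) 1 D.c).mp (by rwa [pow_one]) with h0 | h1
  · exact hc0 h0
  · have : (1 : ℤ) ≤ padicValInt p D.maninConstant := by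
      simpa [ModularParametrizationData.maninConstant] using (show (1 : ℤ) ≤ (padicValInt p D.c : ℤ) by exact_mod_cast h1)
    linarith

/-- The same composition applied to the stubs themselves (audit: the only `sorry`s are the stubs). -/
theorem ManinPrimeToAdditiveFiveLe_of_stubs :
    Summit.BirchSwinnertonDyer.BirchSwinnertonDyer.Theses.ManinLocalTwoThree.ManinPrimeToAdditiveFiveLe :=
  ManinPrimeToAdditiveFiveLe_of stub_neronIntegrality stub_partnerExists

end Summit.BirchSwinnertonDyer.BirchSwinnertonDyer.Cruxes.ManinPrimeToAdditiveFiveLe.NeronPartner
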